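import Mathlib
import Literature.MathematicalPhysics.KineticTheory.RegularStationaryState
import Literature.Analysis.FluidPDE.HardSpherePhaseSpace
import Literature.Analysis.FluidPDE.HardSphereCollisionRecord
import Summits.AtomisticToContinuum.HydrodynamicLimit.Theses.ImplosionDichotomy

/-!
# Sketch — first lemmas of the crux ideas for `HydroLimitInBand` (stmt-AtomisticToContinuum-9133)

Ideator 2, round 1. Nothing here is proved; every `def … : Prop` must ELABORATE over existing
declarations (crux-ideate contract: "First lemma … need not be proved, it must elaborate").

* `DiluteApproximateIsotropy`, `KineticCurrentErgodicityInBand` — card `shell-stosszahlansatz`.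
* `CollisionInformationIdentity`, `FreeProductionBound` — card `collision-information-ledger`.
-/

noncomputable section

open MeasureTheory Set Filter
open scoped ENNReal InnerProductSpace

namespace Summit.AtomisticToContinuum.HydrodynamicLimit.Cruxes.HydroLimitInBand.Ideator2

open Literature.Analysis.FunctionSpaces Literature.Analysis.FluidPDE
open Literature.MathematicalPhysics.KineticTheory

/-- Translation-ERGODICITY of a law on marked configurations of `ℝ³ × ℝ³` (shifts act on
positions): every shift-invariant measurable event is trivial. Inlined (no tree predicate yet). -/
def IsTranslationErgodic (μ : Measure (PointConfig (V3 × V3))) : Prop :=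
  ∀ A : Set (PointConfig (V3 × V3)), MeasurableSet A →
    (∀ a : V3, (PointConfig.translate ((a, (0 : V3)) : V3 × V3)) ⁻¹' A = A) → μ A = 0 ∨ μ A = 1

/-- Zero drift, in `ℝ≥0∞`-friendly form: in every direction the positive and negative parts of the
momentum density agree. -/
def HasZeroDrift (μ : Measure (PointConfig (V3 × V3))) : Prop :=
  ∀ e : V3, PointProcess.markMoment μ (fun v => ENNReal.ofReal (max ⟪v, e⟫_ℝ 0)) =
    PointProcess.markMoment μ (fun v => ENNReal.ofReal (max (-⟪v, e⟫_ℝ) 0))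

/-- **First lemma of card `shell-stosszahlansatz` (DILUTE APPROXIMATE ISOTROPY OF THE KINETIC
STRESS).** For every tolerance `δ > 0` there is a density threshold `η₁ > 0` such that every
translation-ergodic regular stationary state (Bernardin/OVY class `RegularStationaryState`) of ANY
infinite hard-sphere flow of unit diameter in `ℝ³`, of density `< η₁` and zero drift, has a kinetic
stress tensor isotropic up to `δ ×` (kinetic energy density): directional second velocity moments
per unit volume differ by at most `δ · e(μ)`. Mechanism: Palm pull-back of incoming contact pairs
along free-flight tubes of length `s` diameters (`1 ≪ s ≪` mean free path `≍ η⁻¹`), directional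
mean-ergodic theorem (Pugh–Shub) ⇒ molecular chaos of the tube-averaged incoming/outgoing pair laws
up to `o_s(1) + O(sη)`, exact in/out conjugacy by the collision map ⇒ Boltzmann's functional
equation up to that error ⇒ (Lions' gain-term compactness) near-Maxwellian one-particle law. -/
def DiluteApproximateIsotropy : Prop :=
  ∀ δ : ℝ, 0 < δ → ∃ η₁ : ℝ≥0∞, 0 < η₁ ∧
    ∀ (Φ : InfiniteHardSphereFlow (Fin 3) (1 : ℝ)) (μ : Measure (PointConfig (V3 × V3))),
      RegularStationaryState Φ μ → IsTranslationErgodic μ → PointProcess.density μ < η₁ →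
      HasZeroDrift μ →
        ∀ e e' : V3, ‖e‖ = 1 → ‖e'‖ = 1 →
          PointProcess.markMoment μ (fun v => ENNReal.ofReal (⟪v, e⟫_ℝ ^ 2)) ≤
            PointProcess.markMoment μ (fun v => ENNReal.ofReal (⟪v, e'⟫_ℝ ^ 2)) +
              ENNReal.ofReal δ * kineticEnergyDensity μ

/-- **The transfer target of card `shell-stosszahlansatz`, kinetic half (MEAN-CURRENT BOLTZMANN
HYPOTHESIS IN THE BAND, C⁺_kin): EXACT isotropy of the kinetic stress of every translation-ergodic
regular stationary state of density `< η₀`.** Strictly weaker than `IsMacroErgodicAt 1 η₀ Φ`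
(Gibbs mixtures have it), and — with the heat-flux and contact-density companions — exactly what
OVY's one-block step consumes IN MEAN. -/
def KineticCurrentErgodicityInBand : Prop :=
  ∃ η₀ : ℝ≥0∞, 0 < η₀ ∧
    ∀ (Φ : InfiniteHardSphereFlow (Fin 3) (1 : ℝ)) (μ : Measure (PointConfig (V3 × V3))),
      RegularStationaryState Φ μ → IsTranslationErgodic μ → PointProcess.density μ < η₀ →
      HasZeroDrift μ →
        ∀ e e' : V3, ‖e‖ = 1 → ‖e'‖ = 1 →
          PointProcess.markMoment μ (fun v => ENNReal.ofReal (⟪v, e⟫_ℝ ^ 2)) =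
            PointProcess.markMoment μ (fun v => ENNReal.ofReal (⟪v, e'⟫_ℝ ^ 2))

/-- Mutual information of a pair law on `ℝ³ × ℝ³` (KL to the product of its marginals). -/
def pairMutualInfo (π : Measure (V3 × V3)) : ℝ≥0∞ :=
  InformationTheory.klDiv π ((π.map Prod.fst).prod (π.map Prod.snd))

/-- Sum of the relative entropies of the two marginals with respect to the standard Maxwellian
(`stdGaussian`, unit temperature; any fixed Maxwellian would do after an affine change). -/
def marginalNonMaxwellianity (π : Measure (V3 × V3)) : ℝ≥0∞ :=
  InformationTheory.klDiv (π.map Prod.fst) (ProbabilityTheory.stdGaussian V3) +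
    InformationTheory.klDiv (π.map Prod.snd) (ProbabilityTheory.stdGaussian V3)

/-- **First lemma of card `collision-information-ledger` (A COLLISION CREATES EXACTLY AS MUCH
MUTUAL INFORMATION AS IT DESTROYS NON-MAXWELLIANITY).** For every pair law `π` (incoming
velocities of a colliding pair, conditionally on the impact direction `n ≠ 0`) with finite-entropy
marginals, the elastic collision map `T = reflectVel n` (a linear isometry of `ℝ⁶`, an involution,
preserving `γ ⊗ γ`) satisfies
`I(T_*π) + Σ KL((T_*π)_k ‖ γ) = I(π) + Σ KL(π_k ‖ γ)` — both sides equal `KL(π ‖ γ ⊗ γ)` by the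
chain rule. With `I(π) = 0` (molecular chaos) this is Boltzmann's H-theorem per collision in
information units; summed along `HardSphereFlow.collisionSum` it is the ledger of the card. -/
def CollisionInformationIdentity : Prop :=
  ∀ (π : Measure (V3 × V3)) [IsProbabilityMeasure π] (n : V3), n ≠ 0 →
    marginalNonMaxwellianity π ≠ ∞ →
      pairMutualInfo (π.map (reflectVel n)) + marginalNonMaxwellianity (π.map (reflectVel n)) =
        pairMutualInfo π + marginalNonMaxwellianity π

/-- **Companion free fact of card `collision-information-ledger` (THE PRODUCTION OF EVERY ONE-BODY
OBSERVABLE IS `O(N)`, HENCE `O(Kn)` PER COLLISION).** Along the deterministic hard-sphere flows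
started from the local Gibbs laws, for bounded `φ` and Lipschitz `χ`, the expected collisional
production `Σ_{collisions in (0,t]} χ(x_fst)(φ(v_fst⁺) − φ(v_fst⁻))` is bounded by `C·(N+1)`
uniformly in `N` (exact one-body balance: increment of `Σ_i χ(x_i)φ(v_i)` minus the transport term,
both `O(N)` by boundedness and energy conservation), while the number of collisions is
`≍ (N+1)^{4/3}`. -/
def FreeProductionBound : Prop :=
  ∀ (σ : ℝ), 0 < σ → ∀ (a₀ θ₀ : T3 → ℝ) (u₀ : T3 → V3), Continuous a₀ → Continuous θ₀ →
    Continuous u₀ → (∀ x, 0 < a₀ x) → (∀ x, 0 < θ₀ x) →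
    ∀ (t : ℝ), 0 < t → ∀ (φ : V3 → ℝ) (χ : T3 → ℝ), (∃ B, ∀ v, |φ v| ≤ B) → (∃ K, LipschitzWith K χ) →
      ∃ C : ℝ, ∀ (N : ℕ)
        (Φ : HardSphereFlow (Torus.geometry (Fin 3)) (hsDiameter σ N) (N + 1)),
        |∫ z, Φ.collisionSum (Set.Ioc 0 t)
            (fun c => χ c.fstPos * (φ c.postVel.1 - φ c.preVel.1)) z
            ∂(localGibbsLaw σ a₀ u₀ θ₀ N Φ)| ≤ C * (N + 1)

/-- Sanity: the crux decl this sketch serves (by name). -/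
example : Prop := Summit.AtomisticToContinuum.HydrodynamicLimit.Theses.ImplosionDichotomy.HydroLimitInBand

end Summit.AtomisticToContinuum.HydrodynamicLimit.Cruxes.HydroLimitInBand.Ideator2

end
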